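import Summits.Langlands.Langlands.Theorems.RamifiedCoefficientSeedAdjointLiftingGL3BirthDefs3
import Summits.Langlands.Langlands.Theorems.RamifiedCoefficientSeedAdjointLiftingGL3StubGaloisSeedFrob
import Literature.NumberTheory.EllipticCurves.NewformGaloisRepPadicAlgClProofs
import Literature.NumberTheory.EllipticCurves.NewformGaloisRepThm61OfTheoremAProofs
import Literature.NumberTheory.GaloisRepresentations.OrdinaryTwistedDeterminant
import Literature.NumberTheory.Automorphic.ReciprocityGLnCor93Proofs
import HarnessLib

/-!
# Crux `AdjointLiftingGL3` (stmt-Langlands-16779), line `birth`, stub S6 (`stub_galoisSeed`):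
# the trace of `r_ι(Ad(π_g) ⊗ χ)` is the trace of `μ ε_p⁻¹ ⊗ ad⁰ ρ_g`

Steps (7c')–(7d) of the Galois-seed stub.  Data: a newform `g ∈ S₂(Γ₁(M))`, `ι : ℚ̄_p ≃ ℂ`, the
`p`-adic representation `ρ_g : Γ_ℚ → GL₂(ℚ̄_p)` attached to `g` along `ι⁻¹` away from `M p`
(`IsGaloisRepOfNewform1`, arithmetic Frobenius: `det(X − ρ_g(Frob_q)) = X² − ι⁻¹(a_q) X + ι⁻¹(ε(q) q)`),
a cuspidal `π` on `GL₂(𝔸_ℚ)` with the unitary Satake pairs of `g`, a finite-order character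
`μ : Γ_ℚ → GL₁(ℚ̄_p)` and a Hecke character `χ` with `μ(Frob_v) = ι⁻¹(χ(ϖ_v))⁻¹` almost everywhere,
a cuspidal `π₀` on `GL₃(𝔸_ℚ)` with Satake parameter `χ(ϖ_v) · Ad(t_{π,v})` almost everywhere, and
`r : Γ_ℚ → GL₃(ℚ̄_p)` with Harris–Lan–Taylor–Thorne's property for `π₀` (`IsCompatible`).

* `hasFrobCharpolyAt_adZeroTwoTwist` — the characteristic polynomial of Frobenius of the framed
  twist `r' = (μ ε_p⁻¹) ⊗ ad⁰ ρ_g` (`FramedRep.adZeroTwoTwist`) at a place `v ∤ p` where `ρ_g` and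
  `μ` have Frobenius polynomials `X² − t X + e`, `X − m`: it is
  `(X − d)(X² − d (t²/e − 2) X + d²)`, `d = m q_v⁻¹` (`charpoly_adZeroTwoTwist`, `ε_p(Frob_v) = q_v`).
* `trace_eq_trace_adZeroTwoTwist` — **`tr r = tr r'` on all of `Γ_ℚ`**: at almost every `v` both
  `r` (HLTT, through the landed `arithFrobPolyOfSatake_three_adParams`) and `r'` have that
  polynomial as characteristic polynomial of Frobenius, so the landed Chebotarev–continuity lemma
  `trace_eq_of_eventually_hasFrobCharpolyAt` applies.
-/

set_option linter.dupNamespace false -- `Summit.Langlands.Langlands` is the mandated namespace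

noncomputable section

namespace Summit.Langlands.Langlands.Cruxes.AdjointLiftingGL3.Birth

open scoped MatrixGroups NumberField Polynomial
open NumberField IsDedekindDomain Field Filter Polynomial
open Literature.NumberTheory.GaloisRepresentations Literature.NumberTheory.PAdicHodge
open Literature.NumberTheory.Automorphic
open Literature.NumberTheory.EllipticCurves.ModularForms CongruenceSubgroup Rat.HeightOneSpectrum

/-! ## The Frobenius polynomial of `(μ ε_p⁻¹) ⊗ ad⁰ ρ_g` at a good place -/

section Pointwise

variable {p : ℕ} [Fact p.Prime]

/-- Coefficients of the characteristic polynomial of a `2 × 2` matrix: `coeff 0 = det`,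
`coeff 1 = -tr` (Mathlib `Matrix.charpoly_fin_two`). [folklore] -/
private theorem coeff_charpoly_two_aux {R : Type*} [CommRing R] [Nontrivial R]
    (A : Matrix (Fin 2) (Fin 2) R) : A.charpoly.coeff 0 = A.det ∧ A.charpoly.coeff 1 = -A.trace := by
  rw [Matrix.charpoly_fin_two]
  constructor
  · simp [coeff_X_pow, coeff_C, coeff_X]
  · simp [coeff_X_pow, coeff_C]

/-- The value of the twisting character `ψ = det μ · ε_p⁻¹` at `σ`: `μ(σ)₀₀ · ε_p(σ)⁻¹`.
[folklore] -/
theorem coe_detMulCycInv_apply (μ : FramedGaloisRep ℚ (PadicAlgCl p) 1)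
    (σ : absoluteGaloisGroup ℚ) :
    (((FramedRep.det μ * (cyclotomicPadicAlgCl ℚ p)⁻¹) σ : (PadicAlgCl p)ˣ) : PadicAlgCl p) =
      ((μ σ : GL (Fin 1) (PadicAlgCl p)) : Matrix (Fin 1) (Fin 1) (PadicAlgCl p)) 0 0 *
        (((cyclotomicPadicAlgCl ℚ p σ : (PadicAlgCl p)ˣ) : PadicAlgCl p))⁻¹ := by
  rw [ContinuousMonoidHom.mul_apply]
  change (((FramedRep.det μ σ) * (cyclotomicPadicAlgCl ℚ p σ)⁻¹ : (PadicAlgCl p)ˣ) : PadicAlgCl p) = _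
  rw [Units.val_mul, Units.val_inv_eq_inv_val, FramedRep.det_apply,
    Matrix.GeneralLinearGroup.val_det_apply, Matrix.det_fin_one]

/-- **`ε_p(Frob_v) = q_v` in `ℚ̄_p`** for an arithmetic Frobenius above `v ∤ p`
(`GaloisRep.cyclotomicCharacter_apply_of_isArithFrobAt`).
[cite: SerreAbelianLadic1968, Ch. I §1.2 (Example: the cyclotomic character)] -/
theorem coe_cyclotomicPadicAlgCl_of_isArithFrobAt {v : HeightOneSpectrum (𝓞 ℚ)}
    (hpv : ((p : ℕ) : 𝓞 ℚ) ∉ v.asIdeal) {𝔓 : Ideal (absIntegers (𝓞 ℚ) ℚ)} (h𝔓 : 𝔓 ∈ v.primesAbove)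
    {σ : absoluteGaloisGroup ℚ} (hσ : IsArithFrobAt (𝓞 ℚ) σ 𝔓) :
    ((cyclotomicPadicAlgCl ℚ p σ : (PadicAlgCl p)ˣ) : PadicAlgCl p) = (v.residueCard : PadicAlgCl p) := by
  rw [coe_cyclotomicPadicAlgCl_apply, GaloisRep.cyclotomicCharacter_apply_of_isArithFrobAt hpv h𝔓 hσ,
    PadicInt.coe_natCast, map_natCast]

/-- **The Frobenius polynomial of `r' = (μ ε_p⁻¹) ⊗ ad⁰ ρ_g` at a good place.**  If `v ∤ p`,
`det(X − ρ_g(Φ)) = X² − t X + e` and `μ(Φ)₀₀ = m` for every arithmetic Frobenius `Φ` above `v`,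
then every such `Φ` has
`det(X − r'(Φ)) = (X − d)(X² − d (t² e⁻¹ − 2) X + d²)`, `d = m · q_v⁻¹`
(`charpoly_adZeroTwoTwist` and `ε_p(Φ) = q_v`). [folklore] -/
theorem hasFrobCharpolyAt_adZeroTwoTwist (ρg : FramedGaloisRep ℚ (PadicAlgCl p) 2)
    (μ : FramedGaloisRep ℚ (PadicAlgCl p) 1) {v : HeightOneSpectrum (𝓞 ℚ)}
    (hpv : ((p : ℕ) : 𝓞 ℚ) ∉ v.asIdeal) {t e m : PadicAlgCl p}
    (hρ : ρg.HasFrobCharpolyAt v (X ^ 2 - C t * X + C e))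
    (hμ : μ.HasFrobCharpolyAt v (X - C m)) :
    FramedGaloisRep.HasFrobCharpolyAt v
      ((X - C (m * (v.residueCard : PadicAlgCl p)⁻¹)) *
        (X ^ 2 - C ((m * (v.residueCard : PadicAlgCl p)⁻¹) * (t ^ 2 * e⁻¹ - 2)) * X +
          C ((m * (v.residueCard : PadicAlgCl p)⁻¹) ^ 2)))
      (FramedRep.adZeroTwoTwist ρg (FramedRep.det μ * (cyclotomicPadicAlgCl ℚ p)⁻¹)) := by
  intro 𝔓 h𝔓 Φ hΦ
  have hm : ((μ Φ : GL (Fin 1) (PadicAlgCl p)) : Matrix (Fin 1) (Fin 1) (PadicAlgCl p)) 0 0 = m :=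
    (FramedGaloisRep.hasFrobCharpolyAt_iff_of_rank_one μ v m).mp hμ 𝔓 h𝔓 Φ hΦ
  have hd : (((FramedRep.det μ * (cyclotomicPadicAlgCl ℚ p)⁻¹) Φ : (PadicAlgCl p)ˣ) : PadicAlgCl p) =
      m * (v.residueCard : PadicAlgCl p)⁻¹ := by
    rw [coe_detMulCycInv_apply, hm, coe_cyclotomicPadicAlgCl_of_isArithFrobAt hpv h𝔓 hΦ]
  -- trace and determinant of `ρ_g(Φ)` from its characteristic polynomial
  have hP : ((ρg Φ : GL (Fin 2) (PadicAlgCl p)) : Matrix (Fin 2) (Fin 2) (PadicAlgCl p)).charpoly =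
      X ^ 2 - C t * X + C e := hρ 𝔓 h𝔓 Φ hΦ
  have hc := coeff_charpoly_two_aux ((ρg Φ : GL (Fin 2) (PadicAlgCl p)) : Matrix (Fin 2) (Fin 2) (PadicAlgCl p))
  have htr : FramedRep.trace ρg Φ = t := by
    have h1 := hc.2
    rw [hP] at h1
    simp only [coeff_add, coeff_sub, coeff_X_pow, coeff_C_mul, coeff_X_one, coeff_C, mul_one,
      Nat.one_ne_zero, if_false, OfNat.one_ne_ofNat, zero_sub, add_zero, neg_inj] at h1
    exact h1.symm
  have hdet : ((Matrix.GeneralLinearGroup.det (ρg Φ) : (PadicAlgCl p)ˣ) : PadicAlgCl p) = e := by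
    have h0 := hc.1
    rw [hP] at h0
    simp only [coeff_add, coeff_sub, coeff_X_pow, coeff_C_mul, coeff_X_zero, coeff_C_zero,
      mul_zero, sub_zero, OfNat.zero_ne_ofNat, if_false, zero_add] at h0
    rw [Matrix.GeneralLinearGroup.val_det_apply]
    exact h0.symm
  rw [FramedRep.charpoly_adZeroTwoTwist, hd, htr, Units.val_inv_eq_inv_val, hdet]

end Pointwise

/-! ## `tr r = tr r'` everywhere -/

section Global

variable {p : ℕ} [Fact p.Prime]

/-- `ι⁻¹((q c)⁻¹) = ι⁻¹(c⁻¹) · q⁻¹` in `ℚ̄_p`. [folklore] -/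
theorem symm_inv_mul_eq (ι : PadicAlgCl p ≃+* ℂ) (q : ℕ) (c : ℂ) :
    ι.symm (((q : ℂ) * c)⁻¹) = ι.symm c⁻¹ * ((q : PadicAlgCl p))⁻¹ := by
  rw [mul_inv, map_mul, map_inv₀ ι.symm (q : ℂ), map_natCast, mul_comm]

/-- The nebentypus of `g ∈ S_k(Γ₁(M))` does not vanish at a prime `q ∤ M`. [folklore] -/
theorem nebentypus_apply_ne_zero {M : ℕ} [NeZero M] {k : ℤ} (g : CuspForm (Gamma1 M) k) {q : ℕ}
    (hq : q.Prime) (hqM : ¬ q ∣ M) : nebentypus g (q : ZMod M) ≠ 0 := by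
  have hu : IsUnit (q : ZMod M) := (ZMod.isUnit_iff_coprime q M).2 ((Nat.Prime.coprime_iff_not_dvd hq).2 hqM)
  obtain ⟨u, hu⟩ := hu
  rw [← hu, ← MulChar.coe_toUnitHom]
  exact Units.ne_zero _

/-- **`tr r_ι(Ad(π_g) ⊗ χ) = tr ((μ ε_p⁻¹) ⊗ ad⁰ ρ_g)` on `Γ_ℚ`.**  With the data of the module
docstring: at almost every place `v` (namely `v ∤ M p`, `μ(Frob_v) = ι⁻¹(χ(ϖ_v))⁻¹`, and `π₀` with
Satake parameter `χ(ϖ_v) · Ad(α_v)`), Harris–Lan–Taylor–Thorne's property of `r` (over `ℚ` a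
rational prime has one place above it, `Varma2024.corollary93_unramified_rat`) and the landed
`arithFrobPolyOfSatake_three_adParams` give `det(X − r(Frob_v)) = (X − d)(X² − d(t²/e − 2)X + d²)`
with `d = ι⁻¹((q χ(ϖ_v))⁻¹)`, `t = ι⁻¹(a_q)`, `e = ι⁻¹(ε(q) q)`; by
`hasFrobCharpolyAt_adZeroTwoTwist` the framed `r' = (μ ε_p⁻¹) ⊗ ad⁰ ρ_g` has the same polynomial
(`T_q g = a_q g`, `IsNewform1.heckeEigenvalue_eq_coeff_holds`).  Hence `tr r = tr r'` everywhere
(`trace_eq_of_eventually_hasFrobCharpolyAt`: continuity and Chebotarev).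
[cite: HarrisLanTaylorThorneRMS2016, Thm. A (p. 3)] [cite: GelbartJacquet1978, Thm. (9.3)] -/
theorem trace_eq_trace_adZeroTwoTwist :
    ∀ {p : ℕ} [Fact p.Prime] {M : ℕ} [NeZero M] (g : CuspForm (Gamma1 M) 2), IsNewform1 g →
      ∀ (ι : PadicAlgCl p ≃+* ℂ) {hcpt₂ : isCompact_glFiniteIntegralLevel 2 ℚ}
        {hcpt₃ : isCompact_glFiniteIntegralLevel 3 ℚ}
        (π : CuspidalAutomorphicRepData 2 ℚ hcpt₂) (π₀ : CuspidalAutomorphicRepData 3 ℚ hcpt₃)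
        (χ : HeckeCharacter ℚ) (μ : FramedGaloisRep ℚ (PadicAlgCl p) 1)
        (ρg : FramedGaloisRep ℚ (PadicAlgCl p) 2) (r : FramedGaloisRep ℚ (PadicAlgCl p) 3),
        (∀ v : HeightOneSpectrum (𝓞 ℚ), ¬ ((primesEquiv v : Nat.Primes) : ℕ) ∣ M →
          ∃ α : Multiset ℂ, π.1.HasSatakeParamAt v α ∧
            satakePolynomial α = X ^ 2 -
              C (heckeEigenvalue g ((primesEquiv v : Nat.Primes) : ℕ) *
                (((Real.sqrt ((primesEquiv v : Nat.Primes) : ℕ) : ℝ) : ℂ) ^ (1 - (2 : ℤ)))) * X +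
              C (nebentypus g ((((primesEquiv v : Nat.Primes) : ℕ) : ℕ) : ZMod M))) →
        (∀ᶠ v : HeightOneSpectrum (𝓞 ℚ) in cofinite, ∀ α : Multiset ℂ, π.1.HasSatakeParamAt v α →
          π₀.1.HasSatakeParamAt v ((adParams α).map (χ.valueAtUniformizer v * ·))) →
        (∀ᶠ v : HeightOneSpectrum (𝓞 ℚ) in cofinite,
          μ.HasFrobCharpolyAt v (X - C (ι.symm (χ.valueAtUniformizer v)⁻¹))) →
        IsGaloisRepOfNewform1 g
          ((ι.symm : ℂ →+* PadicAlgCl p).comp (algebraMap (coeffCharField g) ℂ)) {q | q ∣ M * p} ρg →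
        HarrisLanTaylorThorne2016.IsCompatible π₀.1 ι r →
        ∀ σ : absoluteGaloisGroup ℚ,
          ((r σ : GL (Fin 3) (PadicAlgCl p)) : Matrix (Fin 3) (Fin 3) (PadicAlgCl p)).trace =
            ((FramedRep.adZeroTwoTwist ρg (FramedRep.det μ * (cyclotomicPadicAlgCl ℚ p)⁻¹) σ :
              GL (Fin 3) (PadicAlgCl p)) : Matrix (Fin 3) (Fin 3) (PadicAlgCl p)).trace := by
  intro p _ M _ g hg ι hcpt₂ hcpt₃ π π₀ χ μ ρg r hsat hπ₀ hμ hρg hrc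
  have hp : p.Prime := Fact.out
  -- the bad places `v ∣ M p` are finitely many
  have hbad : ∀ᶠ v : HeightOneSpectrum (𝓞 ℚ) in cofinite, ¬ ((primesEquiv v : Nat.Primes) : ℕ) ∣ M * p := by
    have hfin : {n : Nat.Primes | (n : ℕ) ∣ M * p}.Finite := by
      refine ((Finset.finite_toSet (M * p).divisors).preimage Nat.Primes.coe_nat_injective.injOn).subset ?_
      intro n hn
      simp only [Set.mem_preimage, Finset.mem_coe, Nat.mem_divisors]
      exact ⟨hn, mul_ne_zero (NeZero.ne M) hp.ne_zero⟩
    have h2 : {v : HeightOneSpectrum (𝓞 ℚ) | ((primesEquiv v : Nat.Primes) : ℕ) ∣ M * p}.Finite := by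
      change (primesEquiv ⁻¹' {n : Nat.Primes | (n : ℕ) ∣ M * p}).Finite
      exact hfin.preimage primesEquiv.injective.injOn
    exact eventually_cofinite.2 (h2.subset fun v hv => not_not.mp hv)
  refine trace_eq_of_eventually_hasFrobCharpolyAt r _ ?_
  filter_upwards [hbad, hπ₀, hμ] with v hv hπ₀v hμv
  set q : ℕ := ((primesEquiv v : Nat.Primes) : ℕ) with hqdef
  have hqprime : q.Prime := (primesEquiv v).2
  have hqM : ¬ q ∣ M := fun h => hv (h.mul_right p)
  have hqp : q ≠ p := fun h => hv (h ▸ dvd_mul_left q M)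
  have hpv : ((p : ℕ) : 𝓞 ℚ) ∉ v.asIdeal :=
    Literature.NumberTheory.EllipticCurves.ModularForms.DeligneSerre1974.natCast_not_mem_asIdeal_of_primesEquiv_ne
      hp hqp
  have hqcard : v.residueCard = q := by rw [Rat.residueCard_eq_natGenerator]; rfl
  obtain ⟨α, hα, hαpoly⟩ := hsat v hqM
  set c : ℂ := χ.valueAtUniformizer v with hcdef
  have hc : c ≠ 0 := Units.ne_zero _
  set a : ℂ := heckeEigenvalue g q with hadef
  set e : ℂ := nebentypus g (q : ZMod M) with hedef
  have he : e ≠ 0 := nebentypus_apply_ne_zero g hqprime hqM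
  -- the side of `r`
  have hr : r.HasFrobCharpolyAt v (arithFrobPolyOfSatake ι q 3 ((adParams α).map (c * ·))) := by
    have h := (Varma2024.corollary93_unramified_rat hrc v hpv _ (hπ₀v α hα)).2
    rwa [hqcard] at h
  rw [arithFrobPolyOfSatake_three_adParams ι q hqprime.pos a e c he hc α hαpoly, symm_inv_mul_eq] at hr
  -- the side of `r'`
  have hqv : ((primesEquiv v : Nat.Primes) : ℕ) ∉ {q | q ∣ M * p} := hv
  have hρv := (hρg v hqv).2
  have hpoly : (heckePolynomial g ((primesEquiv v : Nat.Primes) : ℕ)).map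
      ((ι.symm : ℂ →+* PadicAlgCl p).comp (algebraMap (coeffCharField g) ℂ)) =
      X ^ 2 - C (ι.symm a) * X + C (ι.symm (e * q)) := by
    rw [← Polynomial.map_map, map_heckePolynomial]
    simp only [Polynomial.map_add, Polynomial.map_sub, Polynomial.map_mul, Polynomial.map_pow,
      Polynomial.map_X, Polynomial.map_C, RingHom.coe_coe]
    rw [hadef, IsNewform1.heckeEigenvalue_eq_coeff_holds hg hqprime, hedef,
      show ((2 : ℤ) - 1) = 1 by norm_num, zpow_one]
  rw [hpoly] at hρv
  have hr' := hasFrobCharpolyAt_adZeroTwoTwist ρg μ hpv hρv hμv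
  rw [hqcard] at hr'
  exact ⟨_, hr, hr'⟩

end Global

end Summit.Langlands.Langlands.Cruxes.AdjointLiftingGL3.Birth

end
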